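import Mathlib
import Summits.ValiantsHypothesis.ValiantsHypothesis.Theorems.LiouvilleSarnakLiouvilleCutRankOneScaleBalancedWindow
import Summits.ValiantsHypothesis.ValiantsHypothesis.Theorems.LiouvilleSarnakLiouvilleCutRankOneScaleWindowEmbedding

/-!
# Route LiouvilleSarnak — crux `LiouvilleCutRank` (stmt-ValiantsHypothesis-14775):
# the SHIFTED window embedding and balanced windows with a top margin

The crux `LiouvilleCutRank`: for every `W`, eventually EVERY balanced cut matrix
`M_π(r, c) = λ(N_π(r, c) + 1)` (`π : Fin n ⊕ Fin n ≃ Fin (2n)`, `λ` = Liouville,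
`N_π(r, c) = Nat.ofBits (Sum.elim r c ∘ π.symm)`) has rank `≥ W`.  The registered line `one_scale`
(`Cruxes/LiouvilleCutRank/Lines/one_scale.lean`) collapsed it to ONE scale by freezing the bits
below a balanced window to `1` and the bits ABOVE it to `0`
(`OneScale.rank_inducedCut_le`, `OneScale.stub_balancedWindow`).

This file frees the bits above the window.  Frozen to the binary digits of an ARBITRARY `H`, they
turn the window into the cut matrix of the SHIFTED sequence `x ↦ λ(x + 4^{n₁} H)`, i.e. of the
aligned block `[4^{n₁} H + 1, 4^{n₁} (H + 1)]` of `λ` read through the induced cut `π₁`; to have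
room for the digits of `H` the window must lie below a free top margin:

* §1 `exists_window_count_btwn_margin`, `exists_balancedWindow_margin` — a balanced `2n₁`-window
  with `T` free positions ABOVE it exists in every balanced word of length `2n` as soon as
  `(n₁ + 1)(n₁ + T) ≤ n` (sliding-window counting below the margin: if no window below the top
  `T` positions is balanced, one letter occurs `≤ (n₁ - 1)⌊n/n₁⌋ + (n₁ - 1) + T < n` times).
* §2 `rank_inducedCut_shift_le` — SHIFTED WINDOW EMBEDDING: for the induced cut `π₁` of a balanced
  window `[s, s + 2n₁)` of `π` and every `H < 2^{2n - s - 2n₁}`,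
  `rank (λ(N_{π₁}(r,c) + 4^{n₁} H + 1))_{r,c} ≤ rank M_π`
  (`N_π + 1 = 2^s (N_{π₁} + 4^{n₁} H + 1)` and `λ(2^s x) = (-1)^s λ(x)`).

The consequence — `LiouvilleCutRank` is EQUIVALENT to its one-block form (one rich aligned block
of `λ` per cut word suffices) — is `Theorems/LiouvilleSarnakLiouvilleCutRankOneBlock.lean`.

Honest framing: structural bookkeeping (the number theory of the crux is untouched);
`LiouvilleCutRank` (every `W`; rungs `W ≤ 64` are in the tree), `DigitalBilinearLiouville` and
`AlgebraicSarnak` stay OPEN, and nothing here bears on VP versus VNP.  No definitions.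
-/

-- the directory `ValiantsHypothesis/ValiantsHypothesis` repeats the summit name (tree layout)
set_option linter.dupNamespace false

namespace Summit.ValiantsHypothesis.ValiantsHypothesis.Theorems.LiouvilleSarnakLiouvilleCutRank.OneBlock

open ArithmeticFunction

open Summit.ValiantsHypothesis.ValiantsHypothesis.Theorems.LiouvilleSarnakAligned
  (liouville_two_pow_mul)
open Summit.ValiantsHypothesis.ValiantsHypothesis.Theorems.LiouvilleSarnakCutRankFour
  (count_add_count_not)
open Summit.ValiantsHypothesis.ValiantsHypothesis.Theorems.LiouvilleSarnakCutRankWindow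
  (count_window_succ_le count_le_of_sparse_windows)
open Summit.ValiantsHypothesis.ValiantsHypothesis.Theorems.LiouvilleSarnakLiouvilleCutRank.OneScale
  (exists_inducedCut le_count_word_true le_count_word_false)

/-! ### §1 A balanced window with a free margin above it -/

/-- **Counting lemma with a top margin.**  Let `2c + 2 ≤ K ≤ N ≤ 2n` and
`c ⌊N/K⌋ + min(N mod K, c) + (2n - N) < n`.  If both `p` and `¬ p` hold at `≥ n` of the positions
`< 2n` (a balanced word), some length-`K` window `s, …, s + K - 1 < N` — i.e. BELOW the top
`2n - N` positions — contains strictly more than `c` and strictly fewer than `K - c` positions `k`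
with `p k`: window counts move by `≤ 1`, so avoiding that range keeps every window below `N` at
`≤ c` or every one at `≥ K - c`, and then `p` resp. `¬ p` holds at
`≤ c ⌊N/K⌋ + min(N mod K, c)` positions `< N` plus at most `2n - N` positions in the margin.
[folklore] -/
theorem exists_window_count_btwn_margin (p : ℕ → Prop) [DecidablePred p] (K c n N : ℕ)
    (hKc : 2 * c + 2 ≤ K) (hKN : K ≤ N) (hNn : N ≤ 2 * n)
    (hsmall : c * (N / K) + min (N % K) c + (2 * n - N) < n)
    (hR : n ≤ Nat.count p (2 * n)) (hC : n ≤ Nat.count (fun k => ¬ p k) (2 * n)) :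
    ∃ s, s + K ≤ N ∧ c < Nat.count (fun k => p (s + k)) K ∧
      Nat.count (fun k => p (s + k)) K + c < K := by
  by_contra hno
  push Not at hno
  -- every window count below `N` is `≤ c` or `≥ K - c`
  have hdich : ∀ s, s + K ≤ N →
      Nat.count (fun k => p (s + k)) K ≤ c ∨ K ≤ Nat.count (fun k => p (s + k)) K + c := by
    intro s hs
    by_cases h : c < Nat.count (fun k => p (s + k)) K
    · exact Or.inr (hno s hs h)
    · exact Or.inl (not_lt.mp h)
  -- the two regimes do not mix
  have hregime : (∀ s, s + K ≤ N → Nat.count (fun k => p (s + k)) K ≤ c) ∨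
      (∀ s, s + K ≤ N → K ≤ Nat.count (fun k => p (s + k)) K + c) := by
    rcases hdich 0 (by omega) with h0 | h0
    · left
      intro s
      induction s with
      | zero => exact fun _ => h0
      | succ s ih =>
        intro hs
        have h1 := ih (by omega)
        have h2 := (count_window_succ_le p s K).1
        rcases hdich (s + 1) hs with h3 | h3 <;> omega
    · right
      intro s
      induction s with
      | zero => exact fun _ => h0
      | succ s ih =>
        intro hs
        have h1 := ih (by omega)
        have h2 := (count_window_succ_le p s K).2
        rcases hdich (s + 1) hs with h3 | h3 <;> omega
  -- the margin holds at most `2n - N` positions of either letter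
  have h2n : 2 * n = N + (2 * n - N) := by omega
  rcases hregime with hle | hge
  · have h1 := count_le_of_sparse_windows p K c (by omega) N hKN hle
    have h2 : Nat.count p (2 * n) ≤ Nat.count p N + (2 * n - N) := by
      rw [h2n, Nat.count_add, Nat.add_sub_cancel_left]
      exact Nat.add_le_add_left (Nat.count_le _) _
    omega
  · have hle' : ∀ s, s + K ≤ N → Nat.count (fun k => ¬ p (s + k)) K ≤ c := by
      intro s hs
      have h1 := hge s hs
      have h2 := count_add_count_not (fun k => p (s + k)) K
      omega
    have h1 := count_le_of_sparse_windows (fun k => ¬ p k) K c (by omega) N hKN hle'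
    have h2 : Nat.count (fun k => ¬ p k) (2 * n) ≤
        Nat.count (fun k => ¬ p k) N + (2 * n - N) := by
      rw [h2n, Nat.count_add, Nat.add_sub_cancel_left]
      exact Nat.add_le_add_left (Nat.count_le _) _
    omega

/-- **A balanced window with a free top margin.**  For `(n₁ + 1)(n₁ + T) ≤ n`, the row/column word
`w` of every balanced cut `π` of `2n` positions has `2n₁` consecutive positions
`s, …, s + 2n₁ - 1` containing exactly `n₁` row bits AND lying below the top `T` positions
(`s + 2n₁ + T ≤ 2n`): instance `K = 2n₁`, `c = n₁ - 1`, `N = 2n - T` of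
`exists_window_count_btwn_margin`, whose smallness hypothesis reads
`(n₁ - 1)⌊(2n - T)/(2n₁)⌋ + min(…, n₁ - 1) + T ≤ (n₁ - 1)⌊n/n₁⌋ + (n₁ - 1) + T < n₁ ⌊n/n₁⌋ ≤ n`
because `⌊n/n₁⌋ ≥ n₁ + T`. [folklore] -/
theorem exists_balancedWindow_margin (n₁ T n : ℕ) (hn : (n₁ + 1) * (n₁ + T) ≤ n)
    (π : Fin n ⊕ Fin n ≃ Fin (2 * n)) (w : ℕ → Bool)
    (hw : ∀ j : Fin (2 * n), w j = (π.symm j).isLeft) :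
    ∃ s : ℕ, s + 2 * n₁ + T ≤ 2 * n ∧ Nat.count (fun k => w (s + k) = true) (2 * n₁) = n₁ := by
  have hTn : T ≤ n := by nlinarith [hn]
  rcases Nat.eq_zero_or_pos n₁ with rfl | hpos
  · exact ⟨0, by omega, by simp⟩
  -- `q = ⌊n/n₁⌋ ≥ n₁ + T`
  have hn' : n₁ * (n₁ + T) ≤ n := le_trans (Nat.mul_le_mul_right _ (Nat.le_succ n₁)) hn
  have hq : n₁ + T ≤ n / n₁ := (Nat.le_div_iff_mul_le hpos).mpr (by rwa [Nat.mul_comm] at hn')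
  set q := n / n₁ with hqdef
  have hdivle : (2 * n - T) / (2 * n₁) ≤ q := by
    calc (2 * n - T) / (2 * n₁) ≤ 2 * n / (2 * n₁) := Nat.div_le_div_right (Nat.sub_le _ _)
      _ = q := by rw [hqdef, Nat.mul_div_mul_left n n₁ Nat.two_pos]
  have hmul : (n₁ - 1) * ((2 * n - T) / (2 * n₁)) ≤ (n₁ - 1) * q := Nat.mul_le_mul_left _ hdivle
  have hmin : min ((2 * n - T) % (2 * n₁)) (n₁ - 1) ≤ n₁ - 1 := min_le_right _ _
  have hsum : (n₁ - 1) * q + q = n₁ * q := by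
    rw [← Nat.succ_mul, Nat.succ_eq_add_one, Nat.sub_add_cancel hpos]
  have hnq : n₁ * q ≤ n := by rw [hqdef]; exact Nat.mul_div_le n n₁
  have hsmall : (n₁ - 1) * ((2 * n - T) / (2 * n₁)) + min ((2 * n - T) % (2 * n₁)) (n₁ - 1) +
      (2 * n - (2 * n - T)) < n := by
    omega
  obtain ⟨s, hs, hlo, hhi⟩ := exists_window_count_btwn_margin (fun k => w k = true) (2 * n₁)
    (n₁ - 1) n (2 * n - T) (by omega) (by omega) (Nat.sub_le _ _) hsmall
    (le_count_word_true n π w hw) (le_count_word_false n π w hw)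
  exact ⟨s, by omega, by omega⟩

/-! ### §2 The shifted window embedding -/

/-- **Shifted window embedding for the induced cut.**  Let `s + 2n₁ ≤ 2n`, `w` the row/column word
of the cut `π` on the window `s, …, s + 2n₁ - 1`, `π₁` a level-`n₁` cut with
`(π₁.symm k).isLeft = w (s + k)`, and `H < 2^{2n - s - 2n₁}`.  Then the `π₁`-cut matrix of the
SHIFTED Liouville sequence, `(λ(N_{π₁}(r, c) + 4^{n₁} H + 1))_{r,c}` — the aligned block
`[4^{n₁} H + 1, 4^{n₁}(H + 1)]` of `λ` read through `π₁` — has rank `≤ rank M_π`: with the bits below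
the window frozen to `1` and those above frozen to the binary digits of `H`,
`N_π + 1 = 2^s (N_{π₁} + 4^{n₁} H + 1)` and `λ(2^s x) = (-1)^s λ(x)`, so `(-1)^s` times that matrix
is a submatrix of `M_π`.  (`H = 0` is `OneScale.rank_inducedCut_le`.) [folklore] -/
theorem rank_inducedCut_shift_le (n₁ n : ℕ) (π : Fin n ⊕ Fin n ≃ Fin (2 * n)) (w : ℕ → Bool)
    (s : ℕ) (hs : s + 2 * n₁ ≤ 2 * n)
    (hw : ∀ j : Fin (2 * n), s ≤ (j : ℕ) → (j : ℕ) < s + 2 * n₁ → w j = (π.symm j).isLeft)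
    (π₁ : Fin n₁ ⊕ Fin n₁ ≃ Fin (2 * n₁)) (hπ₁ : ∀ k : Fin (2 * n₁), (π₁.symm k).isLeft = w (s + k))
    (H : ℕ) (hH : H < 2 ^ (2 * n - (s + 2 * n₁))) :
    (Matrix.of fun r c : Fin n₁ → Bool =>
        (((liouville (Nat.ofBits (fun j : Fin (2 * n₁) => Sum.elim r c (π₁.symm j)) +
          2 ^ (2 * n₁) * H + 1) : ℤ) : ℂ))).rank ≤
      (Matrix.of fun r c : Fin n → Bool =>
        (((liouville (Nat.ofBits (fun j : Fin (2 * n) => Sum.elim r c (π.symm j)) + 1) : ℤ) :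
          ℂ))).rank := by
  classical
  set M₁ : Matrix (Fin n₁ → Bool) (Fin n₁ → Bool) ℂ := Matrix.of fun r c : Fin n₁ → Bool =>
      (((liouville (Nat.ofBits (fun j : Fin (2 * n₁) => Sum.elim r c (π₁.symm j)) +
        2 ^ (2 * n₁) * H + 1) : ℤ) : ℂ))
    with hM₁
  set M : Matrix (Fin n → Bool) (Fin n → Bool) ℂ := Matrix.of fun r c : Fin n → Bool =>
      (((liouville (Nat.ofBits (fun j : Fin (2 * n) => Sum.elim r c (π.symm j)) + 1) : ℤ) : ℂ))
    with hM
  -- extension of a local window stream: ones below the window, the digits of `H` above it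
  let ext : (ℕ → Bool) → ℕ → Bool := fun z j =>
    if j < s then true else if j < s + 2 * n₁ then z (j - s) else H.testBit (j - (s + 2 * n₁))
  -- local streams of a level-`n₁` row / column assignment, and the merged stream
  let xr : (Fin n₁ → Bool) → ℕ → Bool := fun r₁ k =>
    if h : k < 2 * n₁ then Sum.elim r₁ (fun _ => false) (π₁.symm ⟨k, h⟩) else false
  let yc : (Fin n₁ → Bool) → ℕ → Bool := fun c₁ k =>
    if h : k < 2 * n₁ then Sum.elim (fun _ => false) c₁ (π₁.symm ⟨k, h⟩) else false
  let z : (Fin n₁ → Bool) → (Fin n₁ → Bool) → ℕ → Bool := fun r₁ c₁ k =>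
    if h : k < 2 * n₁ then Sum.elim r₁ c₁ (π₁.symm ⟨k, h⟩) else false
  -- the row / column embeddings
  let ρ : (Fin n₁ → Bool) → (Fin n → Bool) := fun r₁ i => ext (xr r₁) (π (Sum.inl i))
  let γ : (Fin n₁ → Bool) → (Fin n → Bool) := fun c₁ i => ext (yc c₁) (π (Sum.inr i))
  -- (0) on a row position of the window the merged stream is the row stream, and dually
  have hzr : ∀ r₁ c₁ (k : ℕ) (hk : k < 2 * n₁), (π₁.symm ⟨k, hk⟩).isLeft = true →
      z r₁ c₁ k = xr r₁ k := by
    intro r₁ c₁ k hk hl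
    simp only [z, xr, dif_pos hk]
    rcases hq : π₁.symm ⟨k, hk⟩ with i | i
    · rfl
    · rw [hq, Sum.isLeft_inr] at hl
      exact absurd hl (by decide)
  have hzc : ∀ r₁ c₁ (k : ℕ) (hk : k < 2 * n₁), (π₁.symm ⟨k, hk⟩).isLeft = false →
      z r₁ c₁ k = yc c₁ k := by
    intro r₁ c₁ k hk hl
    simp only [z, yc, dif_pos hk]
    rcases hq : π₁.symm ⟨k, hk⟩ with i | i
    · rw [hq, Sum.isLeft_inl] at hl
      exact absurd hl (by decide)
    · rfl
  -- (1) the global bit vector at `(ρ r₁, γ c₁)` is the extension of the merged local stream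
  have hglob : ∀ r₁ c₁ (j : Fin (2 * n)), Sum.elim (ρ r₁) (γ c₁) (π.symm j) = ext (z r₁ c₁) j := by
    intro r₁ c₁ j
    rcases hj : π.symm j with i | i
    · have hji : π (Sum.inl i) = j := by rw [← hj, Equiv.apply_symm_apply]
      rw [Sum.elim_inl]
      show ext (xr r₁) (π (Sum.inl i)) = ext (z r₁ c₁) j
      rw [hji]
      by_cases h1 : (j : ℕ) < s
      · simp [ext, h1]
      · by_cases h2 : (j : ℕ) < s + 2 * n₁
        · have hk : (j : ℕ) - s < 2 * n₁ := by omega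
          have hl : (π₁.symm ⟨(j : ℕ) - s, hk⟩).isLeft = true := by
            rw [hπ₁, show s + ((j : ℕ) - s) = (j : ℕ) by omega, hw j (not_lt.mp h1) h2, hj,
              Sum.isLeft_inl]
          simp [ext, h1, h2, hzr r₁ c₁ _ hk hl]
        · simp [ext, h1, h2]
    · have hji : π (Sum.inr i) = j := by rw [← hj, Equiv.apply_symm_apply]
      rw [Sum.elim_inr]
      show ext (yc c₁) (π (Sum.inr i)) = ext (z r₁ c₁) j
      rw [hji]
      by_cases h1 : (j : ℕ) < s
      · simp [ext, h1]
      · by_cases h2 : (j : ℕ) < s + 2 * n₁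
        · have hk : (j : ℕ) - s < 2 * n₁ := by omega
          have hl : (π₁.symm ⟨(j : ℕ) - s, hk⟩).isLeft = false := by
            rw [hπ₁, show s + ((j : ℕ) - s) = (j : ℕ) by omega, hw j (not_lt.mp h1) h2, hj,
              Sum.isLeft_inr]
          simp [ext, h1, h2, hzc r₁ c₁ _ hk hl]
        · simp [ext, h1, h2]
  -- (2) the number with extended bits: `N + 1 = 2^s (N₁ + 4^{n₁} H + 1)`
  have hHbit : ∀ i, 2 * n ≤ i → H.testBit (i - (s + 2 * n₁)) = false := fun i hi =>
    Nat.testBit_lt_two_pow (lt_of_lt_of_le hH (Nat.pow_le_pow_right Nat.two_pos (by omega)))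
  have hext : ∀ zz : ℕ → Bool,
      Nat.ofBits (fun j : Fin (2 * n) => ext zz j) + 1 =
        2 ^ s * (Nat.ofBits (fun k : Fin (2 * n₁) => zz k) + 2 ^ (2 * n₁) * H + 1) := by
    intro zz
    have h1 : Nat.ofBits (fun j : Fin (2 * n) => ext zz j) =
        2 ^ s * (2 ^ (2 * n₁) * H + Nat.ofBits (fun k : Fin (2 * n₁) => zz k)) + (2 ^ s - 1) := by
      apply Nat.eq_of_testBit_eq
      intro i
      rw [Nat.testBit_ofBits,
        Nat.testBit_two_pow_mul_add _ (Nat.sub_lt (Nat.two_pow_pos s) Nat.one_pos),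
        Nat.testBit_two_pow_sub_one,
        Nat.testBit_two_pow_mul_add _ (Nat.ofBits_lt_two_pow _), Nat.testBit_ofBits]
      by_cases hi : i < 2 * n
      · rw [dif_pos hi]
        by_cases hi1 : i < s
        · simp [ext, hi1]
        · by_cases hi2 : i < s + 2 * n₁
          · have hi3 : i - s < 2 * n₁ := by omega
            simp [ext, hi1, hi2, hi3]
          · have hi3 : ¬ i - s < 2 * n₁ := by omega
            have hi4 : i - s - 2 * n₁ = i - (s + 2 * n₁) := by omega
            simp [ext, hi1, hi2, hi3, hi4]
      · rw [dif_neg hi]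
        have hi1 : ¬ i < s := by omega
        have hi3 : ¬ i - s < 2 * n₁ := by omega
        have hi4 : i - s - 2 * n₁ = i - (s + 2 * n₁) := by omega
        simp [hi1, hi3, hi4, hHbit i (not_lt.mp hi)]
    calc Nat.ofBits (fun j : Fin (2 * n) => ext zz j) + 1
        = 2 ^ s * (2 ^ (2 * n₁) * H + Nat.ofBits (fun k : Fin (2 * n₁) => zz k)) +
            (2 ^ s - 1) + 1 := by rw [h1]
      _ = 2 ^ s * (2 ^ (2 * n₁) * H + Nat.ofBits (fun k : Fin (2 * n₁) => zz k)) + 2 ^ s := by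
          rw [Nat.add_assoc, Nat.sub_add_cancel Nat.one_le_two_pow]
      _ = 2 ^ s * (Nat.ofBits (fun k : Fin (2 * n₁) => zz k) + 2 ^ (2 * n₁) * H + 1) := by ring
  -- (3) the local number of the merged stream is `N_{π₁}(r₁, c₁)`
  have hloc : ∀ r₁ c₁, (fun k : Fin (2 * n₁) => z r₁ c₁ k) =
      fun k : Fin (2 * n₁) => Sum.elim r₁ c₁ (π₁.symm k) := by
    intro r₁ c₁
    funext k
    simp [z, k.isLt]
  -- (4) entries of the submatrix
  have hentry : ∀ r₁ c₁, M (ρ r₁) (γ c₁) = (-1 : ℂ) ^ s * M₁ r₁ c₁ := by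
    intro r₁ c₁
    have hfun : (fun j : Fin (2 * n) => Sum.elim (ρ r₁) (γ c₁) (π.symm j)) =
        fun j : Fin (2 * n) => ext (z r₁ c₁) j := funext (hglob r₁ c₁)
    have hN : Nat.ofBits (fun j : Fin (2 * n) => Sum.elim (ρ r₁) (γ c₁) (π.symm j)) + 1 =
        2 ^ s * (Nat.ofBits (fun k : Fin (2 * n₁) => Sum.elim r₁ c₁ (π₁.symm k)) +
          2 ^ (2 * n₁) * H + 1) := by
      rw [hfun, hext (z r₁ c₁), hloc r₁ c₁]
    simp only [hM, hM₁, Matrix.of_apply]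
    rw [hN, liouville_two_pow_mul]
    push_cast
    ring
  -- (5) the submatrix is `(-1)^s • M₁`, so `M₁ = (-1)^s • submatrix`
  have hsub : M.submatrix ρ γ = ((-1 : ℂ) ^ s) • M₁ := by
    ext r₁ c₁
    simp only [Matrix.submatrix_apply, Matrix.smul_apply, smul_eq_mul]
    exact hentry r₁ c₁
  have hM₁eq : M₁ = ((-1 : ℂ) ^ s) • M.submatrix ρ γ := by
    rw [hsub, smul_smul, ← mul_pow, neg_one_mul, neg_neg, one_pow, one_smul]
  calc M₁.rank = (((-1 : ℂ) ^ s) • M.submatrix ρ γ).rank := by rw [← hM₁eq]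
    _ = (Matrix.diagonal (fun _ : Fin n₁ → Bool => (-1 : ℂ) ^ s) * M.submatrix ρ γ).rank := by
        rw [Matrix.smul_eq_diagonal_mul]
    _ ≤ (M.submatrix ρ γ).rank := Matrix.rank_mul_le_right _ _
    _ ≤ M.rank := Matrix.rank_submatrix_le M ρ γ

end Summit.ValiantsHypothesis.ValiantsHypothesis.Theorems.LiouvilleSarnakLiouvilleCutRank.OneBlock
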